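import Summits.QuantumFields.YangMills.Theorems.BalabanUVNodesN05SubBP2DSlotExistsOfThm33JunctionHWithQQPP6Guarded
import Literature.MathematicalPhysics.QuantumFieldTheory.Balaban1983to89.B9SupplySockB9P3ZdInstance
import Literature.MathematicalPhysics.QuantumFieldTheory.Balaban1983to89.B9SupplySockB9P3ZdLocalLettersOfOps
import Literature.MathematicalPhysics.QuantumFieldTheory.Balaban1983to89.B9SupplySockB9P3ZdGammaInAkDpZd

/-!
# BalabanUVNodes ∕ N05 ([Balaban1985RegularSpaces] Lemma 1 p. 79 – Thm 8 p. 101): THE «P₂D» ROW WITH THE WITNESS GUARDED — PART 3 of 3: the guarded twins of this seat's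
# `…AtZdFrame` `_zdFrame` (p633678) ∕ `_zdFrameI` (p636957, its v1.1) (N06's full `ℤᵈ` frame of record, `hdict` ∕ `hcurv` discharged): same hypotheses VERBATIM, conclusion
# `∃ lam c₁ ρ₀, 0 < c₁ ∧ 1 ≤ ρ₀ ∧ B8LeafOfRecordSubBP₂D θ (lam.cutSubBP₅ c₁ ρ₀)`

Track A of `YM-PLAN.md` (cell `pub-ymgap`, HUMAN RULING D-0062), node **N05**; seat `pub-ymgap-dag-n05-d` (g14), 2026-08-28; bears on K1⁹ `stmt-QuantumFields-27364`
(`--supports … --as helper`, count-neutral).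

WHY (director-ym №217 (2)(i); ref-D VERDICT-415): the witness must CARRY `0 < c₁ ∧ 1 ≤ ρ₀`.  The guard enters at the root (`…SlotExistsGuarded`) and is threaded through
`…OfThm33JunctionHGuarded` (part 1) and `…WithQQPP6Guarded` (part 2); here through the last two editions of the chain — the pins `(geo, GA, ιLoc) := (geoZd, GAZdFamOfOps ops,
ιLocZd)` resp. `∘ π`, `ops₀ := withDpZd ops₀`, `hdict := dictAt_of_global (dictGlob_zd …)`, `hcurv := curvAtInAk_of_Dp_eq …` exactly as in p633678 ∕ p636957 (NEW module: they are
not re-landed).  With this file EVERY edition of the «P₂D» ∃λ row of record has a guarded twin; the K1 knit's GUARDED slot instance `Slot8′ := fun θ₃ λ₈ => ∃ c₁ ρ₀, 0 < c₁ ∧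
1 ≤ ρ₀ ∧ B8LeafOfRecordSubBP₂D θ₃ (λ₈.cutSubBP₅ c₁ ρ₀)` is served from any of them by `⟨lam, c₁, ρ₀, hc₁, hρ₀, h⟩`.

WHAT IS PROVED (two theorems; no estimate; no new definition):
* ★★★ `exists_residB8_b8LeafOfRecordSubBP₂D_cutSubBP₅_of_letters_thm33_junctionH_zdFrame_guarded` — p633678's hypotheses VERBATIM (SIX binders) ⊢ the GUARDED row.
* ★★★ `exists_residB8_b8LeafOfRecordSubBP₂D_cutSubBP₅_of_letters_thm33_junctionH_zdFrameI_guarded` — p636957 §2's hypotheses VERBATIM (any `I`, `π`, `hmem`) ⊢ the GUARDED row.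
HONEST FRAMING: bookkeeping (the guard threaded); 0 estimates; every displayed hypothesis exactly as in p633678 ∕ p636957 (N06 content; `m ≥ 1` OPEN; class-wide satisfiability NOT
claimed — no supplier road on `Ω₀ = ℤᵈ`; (β′-PERIODIC) is the road of record, director-ym №217 (1)); INDEX NOTE of p633678 and CLASS NOTE (dag-n05-w2) apply verbatim; Proposition 7
in the repaired currency (WATCH-P7-CURRENCY-RECORD); count-neutral; **N05 NOT discharged**; K1⁹ NOT claimed; Bałaban AS PRINTED; one finite 𝕋⁴ programme at fixed ε; nothing
continuum ∕ ℝ⁴ ∕ OS ∕ mass-gap ∕ Clay.  No `sorry`, no new definition.  Unit `pub-ymgap-dag-n05-d` (g14).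
[cite: Balaban1985RegularSpaces, Lemma 1 – Thm 8 pp.79–101, (1.3)–(1.5) p.77, (1.59) p.86; Balaban1985BackgroundPropagators, (3.10) p.392, (3.41) p.397, (3.47) p.398, Thm 3.3 p.399, (3.69) p.404]
-/

noncomputable section

namespace Summit.QuantumFields.YangMills.BalabanUVNodes.N05SubBP2DSlotExistsOfThm33JunctionHAtZdFrameGuarded

open Literature.MathematicalPhysics.QuantumFieldTheory.Balaban1983to89
open Literature.MathematicalPhysics.QuantumFieldTheory.Balaban1983to89.Node00
open Literature.MathematicalPhysics.QuantumFieldTheory.Balaban1983to89.B8IdxB8LawsB (IdxB8LawsB)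
open Literature.MathematicalPhysics.QuantumFieldTheory.Balaban1983to89.B8LeafModelZd (ZdIdx)
open Literature.MathematicalPhysics.QuantumFieldTheory.Balaban1983to89.B8TowerBondsPrinted (towerBondsP)
open Literature.MathematicalPhysics.QuantumFieldTheory.Balaban1983to89.B8SockLettersRD (SockLettersRD)
open Literature.MathematicalPhysics.QuantumFieldTheory.Balaban1983to89.B8Eq138LandauZd (covLap QT)
open B7Prop1Explicit B7Prop2Explicit B7Prop1Local
open B8Ineq132 (InAk covDerivFwd)
open B7Eq78Linearization (zdBlocking QprimeIter)
open B8Eq119TwistedAxial (bgT)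
open B8Eq140Level (SideTouches)
open B8Eq1117Concrete (XSpace)
open B8Prop5ContractionKLevel (Bd2)
open B8LambdaSpaceKLevel (wt)
open B9SupplySockB9P3ZdLetters (OpsZd DictGlob)
open B9SupplySockB9P3ZdAt (DictAt LandauAt SrcAt dictAt_of_global)
open B9SupplySockB9P3ZdAtLin (LinBddAt)
open B9SupplySockB9P3ZdGammaUnivDelta2 (HolderAtδ2)
open B9SupplySockB9P3ZdAtHerm (InvAtH)
open B9SupplySockB9P3ZdGammaUnivDelta2Src (SrcHolderAtδ2)
open B9SupplySockB9P3ZdFrame (MemberZd memZd bgZd ιCfgZd geoZd ιLocZd)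
open B9SupplySockB9P3ZdLocalLettersOfOps (GAZdFamOfOps GAZdFamOfOps_eq)
open B9SupplySockB9P3ZdInstance (dictGlob_zd)
open B9SupplySockB9P3ZdGammaInAkDpZd (withDpZd withDpZd_Dp curvAtInAk_of_Dp_eq)
open B9Eq369CurvSmallZd (DpZd)
open B9Eq316AveragingTransposeZdPrinted (withQQP withQQP_Dp)
open Summit.QuantumFields.YangMills.BalabanUVNodes.N05SubBP2DSlotExistsOfThm33JunctionHWithQQPP6Guarded
  (exists_residB8_b8LeafOfRecordSubBP₂D_cutSubBP₅_of_letters_thm33_junctionH_withQQP_P6_guarded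
    exists_residB8_b8LeafOfRecordSubBP₂D_cutSubBP₅_of_letters_thm33_junctionH_withQQP_P6I_guarded)
-- `Site` alone could resolve to the torus sites of `Setup.lean`; re-export the `ℤ^d` sites of `B7Prop1Explicit`.

export B7Prop1Explicit (Site)

section AtZdFrameGuarded

/-- ★★★ **GUARDED EDITION** (the witness CARRIES `0 < c₁ ∧ 1 ≤ ρ₀` — director-ym №217 (2)(i), ref-D VERDICT-415) of
★★★ **THE J-N06→N05 JUNCTION APPLIED ON THE «P₂D» ROAD AT N06's FULL `ℤᵈ` FRAME OF RECORD, THE DICTIONARY AND THE (3.69) BINDERS DISCHARGED** — for `θ` with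
`2 ≤ θ.D`, `5 ≤ θ.L`: Proposition 6 produces `c35₀, M₆ > 0` such that for every leaf constant `c35 ≥ c35₀` and every junction floor `M₃ ≥ M₆`, [4]'s letters `SLet ∕ SLetUB`,
any length function `len`, any (3.8)-family `Gp`, any letter family `ops` whose `Q*aQ` and `Δ′(U₀)` letters are the genuine ones (`hops`), N06's node sentence
`B9.Thm33Printed c35 (geoZd θ.𝔸 θ.L len) (bgZd θ.𝔸 θ.L) Gp (GAZdFamOfOps θ.𝔸 θ.L len ops)`, and the SIX junction binders `InvAtH ∕ LandauAt ∕ HolderAtδ2 ∕ LinBddAt ∕ SrcAt ∕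
SrcHolderAtδ2` at every `j : Node00.IdxB8SubD θ` give the N05 row `∃ lam c₁ ρ₀, B8LeafOfRecordSubBP₂D θ (lam.cutSubBP₅ c₁ ρ₀)`.  Proof: dag-n05-e's `…_P6` at
`(geo, GA, ιLoc) := (geoZd, GAZdFamOfOps ops, ιLocZd)`, `ops₀ := withDpZd ops₀`, with `hdict := dictAt_of_global (dictGlob_zd …)` and `hcurv := curvAtInAk_of_Dp_eq …`
(`c69 := 14(D−1)`).  Hypotheses are N06 content; N05 NOT discharged.
[cite: Balaban1985RegularSpaces, Lemma 1 – Thm 8 pp.79–101, (1.3)–(1.5) p.77, (1.59) p.86; Balaban1985BackgroundPropagators, (3.10) p.392, (3.41) p.397, (3.47) p.398, Thm 3.3 p.399, (3.69) p.404] -/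
theorem exists_residB8_b8LeafOfRecordSubBP₂D_cutSubBP₅_of_letters_thm33_junctionH_zdFrame_guarded (θ : Stage3Params) (hD : 2 ≤ θ.D) (hL5 : 5 ≤ θ.L)
    [FiniteDimensional ℝ θ.𝔸] :
    ∃ c35₀ M₆ : ℝ, 0 < c35₀ ∧ 0 < M₆ ∧
      ∀ ⦃c35 : ℝ⦄, c35₀ ≤ c35 → ∀ ⦃M₃ : ℝ⦄, M₆ ≤ M₃ →
      -- [Balaban1985BackgroundPropagators] Thm 3.1's letter bounds and threshold
      ∀ {B₀'H B₂' BG BR cL : ℝ}, 0 < B₀'H → 0 ≤ B₂' → 0 ≤ BG → 0 ≤ BR → 0 < cL →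
      -- [4]'s letters AT THE (1.3)–(1.5)-ADMISSIBLE `Ω₀ = ℤᵈ` LAW MEMBERS (p619291's texts verbatim): existence side and uniqueness side
      (∀ i : ZdIdx θ.D θ.L, i.Ω 0 = Set.univ → IdxB8LawsB θ.L i → B8ConstraintBonds.DomainSeq θ.L i.Ω → (∀ l, l < i.k → ∀ z ∈ i.Λs i.k l, ((θ.L : ℤ) ^ l) • z ∈ B8ConstraintBonds.Lam θ.L i.Ω l) → SockLettersRD (𝔸 := θ.𝔸) θ.L BG BR B₀'H B₂' cL i.η i.k i.Ω i.Λs) →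
      (∀ i : ZdIdx θ.D θ.L, i.Ω 0 = Set.univ → IdxB8LawsB θ.L i → B8ConstraintBonds.DomainSeq θ.L i.Ω → (∀ l, l < i.k → ∀ z ∈ i.Λs i.k l, ((θ.L : ℤ) ^ l) • z ∈ B8ConstraintBonds.Lam θ.L i.Ω l) → ∀ α₀ : ℝ, 0 < α₀ → α₀ ≤ cL → ∀ U₀ : Site θ.D → Fin θ.D → θ.𝔸ˣ, (∀ x κ, U₀ x κ ∈ unitaryUnits θ.𝔸) →
        InAk θ.L i.k i.η α₀ i.Ω U₀ →
        ∃ (g Δ : (Site θ.D → θ.𝔸) →ₗ[ℂ] (Site θ.D → θ.𝔸)) (q : (Site θ.D → θ.𝔸) →ₗ[ℂ] (ℕ → Site θ.D → θ.𝔸))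
          (qs : (ℕ → Site θ.D → θ.𝔸) →ₗ[ℂ] (Site θ.D → θ.𝔸)) (Aw c : (ℕ → Site θ.D → θ.𝔸) →ₗ[ℂ] (ℕ → Site θ.D → θ.𝔸))
          (H' : XSpace θ.D i.k θ.𝔸 →ₗ[ℂ] (Site θ.D → θ.𝔸)),
          (∀ x : Site θ.D → θ.𝔸, (∃ C : ℝ, ∀ y, ‖x y‖ ≤ C) → g (Δ x + qs (Aw (q x))) = x) ∧ (∀ φ, qs (c (q (g (g (qs φ))))) = qs φ) ∧
          (∀ (f : Site θ.D → θ.𝔸), ∀ x ∈ i.Ω 0, Δ f x = covLap i.η U₀ ((i.Ω 0).indicator f) x) ∧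
          (∀ (μ : ℕ → Site θ.D → θ.𝔸), ∀ x ∈ i.Ω 0, qs μ x = QT θ.L i.k (i.Λs i.k) U₀ μ x) ∧
          (∀ (f : Site θ.D → θ.𝔸) (n : ℕ), n ≤ i.k → ∀ y ∈ i.Λs i.k n, q f n y = QprimeIter (zdBlocking θ.D θ.L) (bgT θ.L U₀) n f y) ∧
          (∀ (f : Site θ.D → θ.𝔸) (n : ℕ) (y : Site θ.D), ¬ (n ≤ i.k ∧ y ∈ i.Λs i.k n) → q f n y = 0) ∧
          (∀ (X : XSpace θ.D i.k θ.𝔸) (x : Site θ.D), ‖H' X x‖ ≤ B₀'H * ‖X‖) ∧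
          (∀ n, n ≤ i.k → ∀ (X : XSpace θ.D i.k θ.𝔸), ∀ p ∈ {b : Site θ.D × Fin θ.D | SideTouches (i.Ω n) b.1 b.2},
            wt θ.L i.η n * ‖covDerivFwd i.η U₀ p.2 (H' X) p.1‖ ≤ B₀'H * ‖X‖) ∧
          (∀ X : XSpace θ.D i.k θ.𝔸, Bd2 θ.L i.η i.k i.Ω (covLap i.η U₀ (H' X)) (B₂' * ‖X‖)) ∧
          (∀ (Y : XSpace θ.D i.k θ.𝔸) (n : ℕ) (hn : n ≤ i.k) (y : Site θ.D), y ∈ i.Λs i.k n →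
            QprimeIter (zdBlocking θ.D θ.L) (bgT θ.L U₀) n (H' Y) y = Y (⟨n, Nat.lt_succ_of_le hn⟩, y)) ∧
          (∀ (f : Site θ.D → θ.𝔸) (r : ℝ), 0 ≤ r → Bd2 θ.L i.η i.k i.Ω f r →
            (∀ x, ‖g f x‖ ≤ BG * r) ∧ ∀ n, n ≤ i.k → ∀ p ∈ {b : Site θ.D × Fin θ.D | SideTouches (i.Ω n) b.1 b.2},
              wt θ.L i.η n * ‖covDerivFwd i.η U₀ p.2 (g f) p.1‖ ≤ BG * r) ∧
          (∀ (f : Site θ.D → θ.𝔸) (r : ℝ), 0 ≤ r → Bd2 θ.L i.η i.k i.Ω f r → Bd2 θ.L i.η i.k i.Ω (f - g (qs (c (q (g f))))) (BR * r))) →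
      -- N06's `ℤᵈ` FRAME OF RECORD (dag-n06-e): lengths `len`, geometries `geoZd`, backgrounds `bgZd`, the kernel family `GAZdFamOfOps … ops` READ OFF the letters `ops`
      -- (dag-n06-e's `B9SupplySockB9P3ZdLocalLettersOfOps`), locality map `ιLocZd`; the (3.8)-side family `Gp` of Theorems 3.1–3.2 stays free (read by `Thm33Printed` only)
      ∀ (len : Site θ.D → ℝ) (Gp : ∀ x, B9.KernelFamily (geoZd θ.𝔸 θ.L len x) (bgZd θ.𝔸 θ.L x))
        (ops : ℝ → ZdIdx θ.D θ.L → ℕ → OpsZd θ.D θ.𝔸)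
      -- THE GENUINE AVERAGING LETTER `Q*aQ` (EDITION P, dag-n06-b) AND THE GENUINE CURVATURE LETTER `Δ′(U₀)` (dag-n06-w2's `withDpZd`), pinned pointwise
        (τ : θ.𝔸 →ₗ[ℂ] ℂ) {Cτ : ℝ}, (∀ x y : θ.𝔸, |(τ (star x * y)).re| ≤ Cτ * ‖x‖ * ‖y‖) →
      ∀ (ops₀ : ℝ → ZdIdx θ.D θ.L → ℕ → OpsZd θ.D θ.𝔸),
        (∀ (M : ℝ) (i : ZdIdx θ.D θ.L) (m : ℕ), ops M i m = withQQP τ θ.L (fun m' l => towerBondsP θ.L i.Ω (i.Λs m') l) (withDpZd ops₀) M i m) →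
      ∀ {a₃ β cS cSβ : ℝ} {CH : ℝ → ℝ},
      -- N06's THEOREM 3.3 AS PRINTED — ITS NODE SENTENCE (γ) AT THE `ℤᵈ` FRAME OF RECORD, VERBATIM (the kernel family of `G(U₀)` read off `ops`)
        B9.Thm33Printed c35 (geoZd θ.𝔸 θ.L len) (bgZd θ.𝔸 θ.L) Gp (GAZdFamOfOps θ.𝔸 θ.L len ops) →
      -- dag-n06-b's JUNCTION BINDERS at the (1.3)–(1.5)-admissible members, guarded — SIX of them: NO `havg` (dag-n05-d g13 C), NO `hP6` (dag-n05-e), NO `hdict`, NO `hcurv` (this file)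
        (∀ (M : ℝ) (j : IdxB8SubD θ) (m : ℕ), 1 ≤ M → M₃ ≤ M → m ≤ j.1.1.1.1.k → InvAtH (bgZd θ.𝔸 θ.L) θ.L memZd (ιCfgZd θ.𝔸 θ.L) ops c35 a₃ M j.1.1.1.1 m) →
        (∀ (M : ℝ) (j : IdxB8SubD θ) (m : ℕ), 1 ≤ M → M₃ ≤ M → m ≤ j.1.1.1.1.k → LandauAt (bgZd θ.𝔸 θ.L) θ.L memZd (ιCfgZd θ.𝔸 θ.L) ops c35 a₃ M j.1.1.1.1 m) →
        (∀ (M : ℝ) (j : IdxB8SubD θ) (m : ℕ), 1 ≤ M → M₃ ≤ M → m ≤ j.1.1.1.1.k → HolderAtδ2 (geoZd θ.𝔸 θ.L len) (bgZd θ.𝔸 θ.L) (GAZdFamOfOps θ.𝔸 θ.L len ops) θ.L memZd (ιCfgZd θ.𝔸 θ.L) ops β len CH M j.1.1.1.1 m) →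
        (∀ (M : ℝ) (j : IdxB8SubD θ) (m : ℕ), 1 ≤ M → M₃ ≤ M → m ≤ j.1.1.1.1.k → LinBddAt θ.L ops M j.1.1.1.1 m) →
        (∀ (M : ℝ) (j : IdxB8SubD θ) (m : ℕ), 1 ≤ M → M₃ ≤ M → m ≤ j.1.1.1.1.k → SrcAt (bgZd θ.𝔸 θ.L) θ.L memZd (ιCfgZd θ.𝔸 θ.L) ops c35 a₃ cS M j.1.1.1.1 m) →
        (∀ (M : ℝ) (j : IdxB8SubD θ) (m : ℕ), 1 ≤ M → M₃ ≤ M → m ≤ j.1.1.1.1.k → SrcHolderAtδ2 (bgZd θ.𝔸 θ.L) θ.L memZd (ιCfgZd θ.𝔸 θ.L) ops c35 a₃ β len cSβ M j.1.1.1.1 m) →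
      -- the junction's primitive constants ((3.27) `a₃`, source `c_S c_Sβ`; (3.69)'s `c69` is now `14(D−1)`, dag-n06-w2) and Theorem 8's source size factor `γ₈`
        0 < a₃ → 0 ≤ cS → 0 ≤ cSβ → ∀ {γ₈ : ℝ}, 1 ≤ γ₈ →
        ∃ (lam : ResidB8 θ) (c₁ : ℝ) (ρ₀ : ℕ), 0 < c₁ ∧ 1 ≤ ρ₀ ∧ B8LeafOfRecordSubBP₂D θ (lam.cutSubBP₅ c₁ ρ₀) := by
  have hL1 : 1 ≤ θ.L := le_trans (by norm_num) hL5
  -- dag-n05-e's P₆-discharged row at an ABSTRACT half-frame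
  obtain ⟨c35₀, M₆, hc35₀, hM₆, H⟩ :=
    exists_residB8_b8LeafOfRecordSubBP₂D_cutSubBP₅_of_letters_thm33_junctionH_withQQP_P6_guarded θ hD hL5
  refine ⟨c35₀, M₆, hc35₀, hM₆, ?_⟩
  intro c35 hc35 M₃ hM₃ B₀'H B₂' BG BR cL hB₀'H hB₂' hBG hBR hcL SLet SLetUB len Gp ops τ Cτ hCτ ops₀ hops a₃ β cS cSβ CH
    h33 hinv hlan hhol hlin hsrc hsrcH ha₃ hcS hcSβ γ₈ hγ₈
  -- THE NORM DICTIONARY IS A THEOREM AT N06's FRAME OF RECORD, for THIS `ops` (dag-n06-e `dictGlob_zd`, read through `GAZdFamOfOps_eq`)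
  have hDG : DictGlob (geoZd θ.𝔸 θ.L len) (bgZd θ.𝔸 θ.L) (GAZdFamOfOps θ.𝔸 θ.L len ops) θ.L memZd (ιCfgZd θ.𝔸 θ.L) (ιLocZd θ.𝔸 θ.L len) ops := by
    rw [GAZdFamOfOps_eq]
    exact dictGlob_zd len ops _
  -- THE CURVATURE LETTER IS GENUINE AT EVERY MEMBER (the pin, dag-n06-b `withQQP_Dp`, dag-n06-w2 `withDpZd_Dp`)
  have hDp : ∀ (M : ℝ) (i : ZdIdx θ.D θ.L) (m : ℕ), (ops M i m).Dp = DpZd i.η := fun M i m => by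
    rw [hops, withQQP_Dp, withDpZd_Dp]
  exact H hc35 hM₃ hB₀'H hB₂' hBG hBR hcL SLet SLetUB (geoZd θ.𝔸 θ.L len) Gp (GAZdFamOfOps θ.𝔸 θ.L len ops) (ιLocZd θ.𝔸 θ.L len) ops τ hCτ
    (withDpZd ops₀) hops h33 (fun M j m _ _ _ => dictAt_of_global hDG M j.1.1.1.1 m) hinv
    (fun M j m hM1 _ _ => curvAtInAk_of_Dp_eq hL1 hDp hM1 j.1.1.1.1 m) hlan hhol hlin hsrc hsrcH ha₃ (by positivity) hcS hcSβ hγ₈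

end AtZdFrameGuarded

section AtZdFrameIGuarded


/-- ★★★ **GUARDED EDITION** (the witness CARRIES `0 < c₁ ∧ 1 ≤ ρ₀` — director-ym №217 (2)(i), ref-D VERDICT-415) of
★★★ **THE INDEX-GENERIC EDITION (§2, v1.1): THE `ℤᵈ` FRAME OF RECORD THROUGH A RE-INDEXING MAP `π : I → MemberZd θ.D θ.L`** — for `θ` with `2 ≤ θ.D`, `5 ≤ θ.L`:
Proposition 6 produces `c35₀, M₆ > 0` such that for every `c35 ≥ c35₀`, `M₃ ≥ M₆`, [4]'s letters `SLet ∕ SLetUB`, any index `I` with `π : I → MemberZd θ.D θ.L`, member map `mem`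
with `π (mem M j m) = memZd M j m` at the admissible members, any `len`, any (3.8)-family `Gp` over `I`, any letter family `ops` with the pin `hops` (genuine `Q*aQ`, `Δ′`),
N06's sentence `B9.Thm33Printed c35 (geoZd … ∘ π) (bgZd … ∘ π) Gp (GAZdFamOfOps … ops ∘ π)` OVER `I` (sound sub-indices are the consumer's choice — dag-n06-b LOCATED-SELF-7),
and the SIX junction binders at every `j : Node00.IdxB8SubD θ` give `∃ lam c₁ ρ₀, B8LeafOfRecordSubBP₂D θ (lam.cutSubBP₅ c₁ ρ₀)`.  Proof: dag-n05-e's `…_P6I` at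
`(geo, GA, ιLoc) := (geoZd ∘ π, GAZdFamOfOps ops ∘ π, id)`, `ops₀ := withDpZd ops₀`; `hcurv := curvAtInAk_of_Dp_eq`; `hdict` = the frame-of-record dictionary
`dictAt_of_global (dictGlob_zd …)` TRANSPORTED along `hmem` (the binder unfolded, `π (mem M j m)` rewritten to `memZd M j m`).  Hypotheses are N06 content; N05 NOT discharged.
[cite: Balaban1985RegularSpaces, Lemma 1 – Thm 8 pp.79–101, (1.3)–(1.5) p.77, (1.59) p.86; Balaban1985BackgroundPropagators, (3.10) p.392, (3.41) p.397, (3.47) p.398, Thm 3.3 p.399, (3.69) p.404] -/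
theorem exists_residB8_b8LeafOfRecordSubBP₂D_cutSubBP₅_of_letters_thm33_junctionH_zdFrameI_guarded (θ : Stage3Params) (hD : 2 ≤ θ.D) (hL5 : 5 ≤ θ.L)
    [FiniteDimensional ℝ θ.𝔸] :
    ∃ c35₀ M₆ : ℝ, 0 < c35₀ ∧ 0 < M₆ ∧
      ∀ ⦃c35 : ℝ⦄, c35₀ ≤ c35 → ∀ ⦃M₃ : ℝ⦄, M₆ ≤ M₃ →
      -- [Balaban1985BackgroundPropagators] Thm 3.1's letter bounds and threshold
      ∀ {B₀'H B₂' BG BR cL : ℝ}, 0 < B₀'H → 0 ≤ B₂' → 0 ≤ BG → 0 ≤ BR → 0 < cL →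
      -- [4]'s letters AT THE (1.3)–(1.5)-ADMISSIBLE `Ω₀ = ℤᵈ` LAW MEMBERS (p619291's texts verbatim): existence side and uniqueness side
      (∀ i : ZdIdx θ.D θ.L, i.Ω 0 = Set.univ → IdxB8LawsB θ.L i → B8ConstraintBonds.DomainSeq θ.L i.Ω → (∀ l, l < i.k → ∀ z ∈ i.Λs i.k l, ((θ.L : ℤ) ^ l) • z ∈ B8ConstraintBonds.Lam θ.L i.Ω l) → SockLettersRD (𝔸 := θ.𝔸) θ.L BG BR B₀'H B₂' cL i.η i.k i.Ω i.Λs) →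
      (∀ i : ZdIdx θ.D θ.L, i.Ω 0 = Set.univ → IdxB8LawsB θ.L i → B8ConstraintBonds.DomainSeq θ.L i.Ω → (∀ l, l < i.k → ∀ z ∈ i.Λs i.k l, ((θ.L : ℤ) ^ l) • z ∈ B8ConstraintBonds.Lam θ.L i.Ω l) → ∀ α₀ : ℝ, 0 < α₀ → α₀ ≤ cL → ∀ U₀ : Site θ.D → Fin θ.D → θ.𝔸ˣ, (∀ x κ, U₀ x κ ∈ unitaryUnits θ.𝔸) →
        InAk θ.L i.k i.η α₀ i.Ω U₀ →
        ∃ (g Δ : (Site θ.D → θ.𝔸) →ₗ[ℂ] (Site θ.D → θ.𝔸)) (q : (Site θ.D → θ.𝔸) →ₗ[ℂ] (ℕ → Site θ.D → θ.𝔸))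
          (qs : (ℕ → Site θ.D → θ.𝔸) →ₗ[ℂ] (Site θ.D → θ.𝔸)) (Aw c : (ℕ → Site θ.D → θ.𝔸) →ₗ[ℂ] (ℕ → Site θ.D → θ.𝔸))
          (H' : XSpace θ.D i.k θ.𝔸 →ₗ[ℂ] (Site θ.D → θ.𝔸)),
          (∀ x : Site θ.D → θ.𝔸, (∃ C : ℝ, ∀ y, ‖x y‖ ≤ C) → g (Δ x + qs (Aw (q x))) = x) ∧ (∀ φ, qs (c (q (g (g (qs φ))))) = qs φ) ∧
          (∀ (f : Site θ.D → θ.𝔸), ∀ x ∈ i.Ω 0, Δ f x = covLap i.η U₀ ((i.Ω 0).indicator f) x) ∧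
          (∀ (μ : ℕ → Site θ.D → θ.𝔸), ∀ x ∈ i.Ω 0, qs μ x = QT θ.L i.k (i.Λs i.k) U₀ μ x) ∧
          (∀ (f : Site θ.D → θ.𝔸) (n : ℕ), n ≤ i.k → ∀ y ∈ i.Λs i.k n, q f n y = QprimeIter (zdBlocking θ.D θ.L) (bgT θ.L U₀) n f y) ∧
          (∀ (f : Site θ.D → θ.𝔸) (n : ℕ) (y : Site θ.D), ¬ (n ≤ i.k ∧ y ∈ i.Λs i.k n) → q f n y = 0) ∧
          (∀ (X : XSpace θ.D i.k θ.𝔸) (x : Site θ.D), ‖H' X x‖ ≤ B₀'H * ‖X‖) ∧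
          (∀ n, n ≤ i.k → ∀ (X : XSpace θ.D i.k θ.𝔸), ∀ p ∈ {b : Site θ.D × Fin θ.D | SideTouches (i.Ω n) b.1 b.2},
            wt θ.L i.η n * ‖covDerivFwd i.η U₀ p.2 (H' X) p.1‖ ≤ B₀'H * ‖X‖) ∧
          (∀ X : XSpace θ.D i.k θ.𝔸, Bd2 θ.L i.η i.k i.Ω (covLap i.η U₀ (H' X)) (B₂' * ‖X‖)) ∧
          (∀ (Y : XSpace θ.D i.k θ.𝔸) (n : ℕ) (hn : n ≤ i.k) (y : Site θ.D), y ∈ i.Λs i.k n →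
            QprimeIter (zdBlocking θ.D θ.L) (bgT θ.L U₀) n (H' Y) y = Y (⟨n, Nat.lt_succ_of_le hn⟩, y)) ∧
          (∀ (f : Site θ.D → θ.𝔸) (r : ℝ), 0 ≤ r → Bd2 θ.L i.η i.k i.Ω f r →
            (∀ x, ‖g f x‖ ≤ BG * r) ∧ ∀ n, n ≤ i.k → ∀ p ∈ {b : Site θ.D × Fin θ.D | SideTouches (i.Ω n) b.1 b.2},
              wt θ.L i.η n * ‖covDerivFwd i.η U₀ p.2 (g f) p.1‖ ≤ BG * r) ∧
          (∀ (f : Site θ.D → θ.𝔸) (r : ℝ), 0 ≤ r → Bd2 θ.L i.η i.k i.Ω f r → Bd2 θ.L i.η i.k i.Ω (f - g (qs (c (q (g f))))) (BR * r))) →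
      -- ANY INDEX re-indexed into the `ℤᵈ` members of record by `π`, a member map landing on `memZd` at the admissible members, and N06's `ℤᵈ` FRAME OF RECORD
      -- READ THROUGH `π` (dag-n06-e): lengths `len`, geometries `geoZd ∘ π`, backgrounds `bgZd ∘ π`, the kernel family `GAZdFamOfOps … ops ∘ π` READ OFF the letters `ops`,
      -- locality map the identity; the (3.8)-side family `Gp` of Theorems 3.1–3.2 stays free (read by `Thm33Printed` only)
      ∀ {I : Type} (π : I → MemberZd θ.D θ.L) (len : Site θ.D → ℝ) (Gp : ∀ i, B9.KernelFamily (geoZd θ.𝔸 θ.L len (π i)) (bgZd θ.𝔸 θ.L (π i)))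
        (mem : ℝ → ZdIdx θ.D θ.L → ℕ → I),
        (∀ (M : ℝ) (j : IdxB8SubD θ) (m : ℕ), π (mem M j.1.1.1.1 m) = memZd M j.1.1.1.1 m) →
      ∀ (ops : ℝ → ZdIdx θ.D θ.L → ℕ → OpsZd θ.D θ.𝔸)
      -- THE GENUINE AVERAGING LETTER `Q*aQ` (EDITION P, dag-n06-b) AND THE GENUINE CURVATURE LETTER `Δ′(U₀)` (dag-n06-w2's `withDpZd`), pinned pointwise
        (τ : θ.𝔸 →ₗ[ℂ] ℂ) {Cτ : ℝ}, (∀ x y : θ.𝔸, |(τ (star x * y)).re| ≤ Cτ * ‖x‖ * ‖y‖) →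
      ∀ (ops₀ : ℝ → ZdIdx θ.D θ.L → ℕ → OpsZd θ.D θ.𝔸),
        (∀ (M : ℝ) (i : ZdIdx θ.D θ.L) (m : ℕ), ops M i m = withQQP τ θ.L (fun m' l => towerBondsP θ.L i.Ω (i.Λs m') l) (withDpZd ops₀) M i m) →
      ∀ {a₃ β cS cSβ : ℝ} {CH : ℝ → ℝ},
      -- N06's THEOREM 3.3 AS PRINTED — ITS NODE SENTENCE (γ) AT THE `ℤᵈ` FRAME OF RECORD READ THROUGH `π` (over `I`: sound sub-indices are the consumer's choice)
        B9.Thm33Printed c35 (fun i => geoZd θ.𝔸 θ.L len (π i)) (fun i => bgZd θ.𝔸 θ.L (π i)) Gp (fun i => GAZdFamOfOps θ.𝔸 θ.L len ops (π i)) →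
      -- dag-n06-b's JUNCTION BINDERS at the (1.3)–(1.5)-admissible members, guarded — SIX of them: NO `havg` (dag-n05-d g13 C), NO `hP6` (dag-n05-e), NO `hdict`, NO `hcurv` (this file)
        (∀ (M : ℝ) (j : IdxB8SubD θ) (m : ℕ), 1 ≤ M → M₃ ≤ M → m ≤ j.1.1.1.1.k → InvAtH (fun i => bgZd θ.𝔸 θ.L (π i)) θ.L mem (fun M i m U₀ hU₀ => ιCfgZd θ.𝔸 θ.L M i m U₀ hU₀) ops c35 a₃ M j.1.1.1.1 m) →
        (∀ (M : ℝ) (j : IdxB8SubD θ) (m : ℕ), 1 ≤ M → M₃ ≤ M → m ≤ j.1.1.1.1.k → LandauAt (fun i => bgZd θ.𝔸 θ.L (π i)) θ.L mem (fun M i m U₀ hU₀ => ιCfgZd θ.𝔸 θ.L M i m U₀ hU₀) ops c35 a₃ M j.1.1.1.1 m) →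
        (∀ (M : ℝ) (j : IdxB8SubD θ) (m : ℕ), 1 ≤ M → M₃ ≤ M → m ≤ j.1.1.1.1.k → HolderAtδ2 (fun i => geoZd θ.𝔸 θ.L len (π i)) (fun i => bgZd θ.𝔸 θ.L (π i)) (fun i => GAZdFamOfOps θ.𝔸 θ.L len ops (π i)) θ.L mem (fun M i m U₀ hU₀ => ιCfgZd θ.𝔸 θ.L M i m U₀ hU₀) ops β len CH M j.1.1.1.1 m) →
        (∀ (M : ℝ) (j : IdxB8SubD θ) (m : ℕ), 1 ≤ M → M₃ ≤ M → m ≤ j.1.1.1.1.k → LinBddAt θ.L ops M j.1.1.1.1 m) →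
        (∀ (M : ℝ) (j : IdxB8SubD θ) (m : ℕ), 1 ≤ M → M₃ ≤ M → m ≤ j.1.1.1.1.k → SrcAt (fun i => bgZd θ.𝔸 θ.L (π i)) θ.L mem (fun M i m U₀ hU₀ => ιCfgZd θ.𝔸 θ.L M i m U₀ hU₀) ops c35 a₃ cS M j.1.1.1.1 m) →
        (∀ (M : ℝ) (j : IdxB8SubD θ) (m : ℕ), 1 ≤ M → M₃ ≤ M → m ≤ j.1.1.1.1.k → SrcHolderAtδ2 (fun i => bgZd θ.𝔸 θ.L (π i)) θ.L mem (fun M i m U₀ hU₀ => ιCfgZd θ.𝔸 θ.L M i m U₀ hU₀) ops c35 a₃ β len cSβ M j.1.1.1.1 m) →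
      -- the junction's primitive constants ((3.27) `a₃`, source `c_S c_Sβ`; (3.69)'s `c69` is now `14(D−1)`, dag-n06-w2) and Theorem 8's source size factor `γ₈`
        0 < a₃ → 0 ≤ cS → 0 ≤ cSβ → ∀ {γ₈ : ℝ}, 1 ≤ γ₈ →
        ∃ (lam : ResidB8 θ) (c₁ : ℝ) (ρ₀ : ℕ), 0 < c₁ ∧ 1 ≤ ρ₀ ∧ B8LeafOfRecordSubBP₂D θ (lam.cutSubBP₅ c₁ ρ₀) := by
  have hL1 : 1 ≤ θ.L := le_trans (by norm_num) hL5
  obtain ⟨c35₀, M₆, hc35₀, hM₆, H⟩ :=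
    exists_residB8_b8LeafOfRecordSubBP₂D_cutSubBP₅_of_letters_thm33_junctionH_withQQP_P6I_guarded θ hD hL5
  refine ⟨c35₀, M₆, hc35₀, hM₆, ?_⟩
  intro c35 hc35 M₃ hM₃ B₀'H B₂' BG BR cL hB₀'H hB₂' hBG hBR hcL SLet SLetUB I π len Gp mem hmem ops τ Cτ hCτ ops₀ hops a₃ β cS cSβ CH
    h33 hinv hlan hhol hlin hsrc hsrcH ha₃ hcS hcSβ γ₈ hγ₈
  -- THE NORM DICTIONARY IS A THEOREM AT N06's FRAME OF RECORD, for THIS `ops` (dag-n06-e `dictGlob_zd`, read through `GAZdFamOfOps_eq`)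
  have hDG : DictGlob (geoZd θ.𝔸 θ.L len) (bgZd θ.𝔸 θ.L) (GAZdFamOfOps θ.𝔸 θ.L len ops) θ.L memZd (ιCfgZd θ.𝔸 θ.L) (ιLocZd θ.𝔸 θ.L len) ops := by
    rw [GAZdFamOfOps_eq]
    exact dictGlob_zd len ops _
  -- THE CURVATURE LETTER IS GENUINE AT EVERY MEMBER (the pin)
  have hDp : ∀ (M : ℝ) (i : ZdIdx θ.D θ.L) (m : ℕ), (ops M i m).Dp = DpZd i.η := fun M i m => by
    rw [hops, withQQP_Dp, withDpZd_Dp]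
  refine H hc35 hM₃ hB₀'H hB₂' hBG hBR hcL SLet SLetUB π (fun i => geoZd θ.𝔸 θ.L len (π i)) Gp (fun i => GAZdFamOfOps θ.𝔸 θ.L len ops (π i)) mem hmem
    (fun M i m J => J) ops τ hCτ (withDpZd ops₀) hops h33 ?_ hinv (fun M j m hM1 _ _ => curvAtInAk_of_Dp_eq hL1 hDp hM1 j.1.1.1.1 m) hlan hhol hlin hsrc hsrcH
    ha₃ (by positivity) hcS hcSβ hγ₈
  -- `hdict` AT THE GENERIC INDEX: the frame-of-record dictionary at `memZd M j m`, transported along `hmem`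
  intro M j m _ _ _
  have h := dictAt_of_global hDG M j.1.1.1.1 m
  simp only [DictAt] at h ⊢
  rw [hmem M j m]
  exact h

end AtZdFrameIGuarded

end Summit.QuantumFields.YangMills.BalabanUVNodes.N05SubBP2DSlotExistsOfThm33JunctionHAtZdFrameGuarded

end
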